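import Literature.MathematicalPhysics.QuantumFieldTheory.Balaban1983to89.Beta.ShellRiemann
import Literature.Analysis.FluidPDE.SphereIntegral

/-!
# `Balaban1983to89.Beta.ShellValue` — the VALUE of the transverse shell integral:
`∫_{1<‖x‖_∞≤2} 24·x_μ²x_ν²/|x|₂⁸ dx = 2π²·log 2` (μ ≠ ν), hence `LeadingCoefficient.unitCoeff μ ν = transverseValue`
(β sub-cell, lead's kernel node BETA-LEAD-SHELLVALUE; closes cell GAPS G-beta-an3-5 entirely, together with `Beta.ShellRiemann`)

HONEST FRAMING (cell rule, verbatim): discharging `BetaPertH` makes Bałaban's UV stability UNCONDITIONAL — a real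
constructive-QFT result; it is NOT the continuum limit and NOT the Clay problem.  (Gloss, BETA-SPEC v1.8d/v1.9b
l. 17–18, GAPS G-ref2-14 (a) / G-ref2-20 (a), verbatim: «UNCONDITIONAL» in [Balaban1989LargeFieldII] (B16) p. 355's
interval-hypothesis sense ONLY
(`FlowStepRuns.p355Unconditional_of_partialSums` keeps `hnodes`); the located leaves G-adv3-2 (left inequality of
(0.1)/(2.50), d = 4), G-adv3-1 (U2 transfer of B14 Cor. 3's lower bound) and `SecondExpLeaf` REMAIN.)
THIS MODULE DISCHARGES NOTHING of the
series and asserts nothing about Bałaban's β-functions: it is calculus on `ℝ⁴` (dilation invariance of the measure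
`F(x)dx` for a degree-`−4` homogeneous `F`, polar coordinates via the tree's `Literature.Analysis.FluidPDE.SphereIntegral`,
and a four-dimensional Gaussian product integral), composed BY NAME with `Beta.ShellRiemann` / `Beta.LeadingCoefficient`.
Every declaration is `[folklore]`.  Value = the printed one-loop slope dictionary of `Beta.LeadingCoefficient` §5 becomes
BINDER-FREE in the kernel: GIVEN the shape hypothesis with `κ = kappaBal N`, the (AF-0-L) slope IS `stepBal N L / log L =
11N²/(12π²)` (`logGrowthLower_stepBal'`) — NOT summit progress (audit cell `pub-balaban`, unit `b2b-balaban-strat-b12` gen 5;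
specs `BETA-SPEC.md` v1.9 §8.6 (r), `MISSING-B12.md` v3.5 §12; paper computation `BETA/AN3.md` v3 §6.3 (a), numerics (c) and
referee cubature GAPS C-beta-68).
v1.1 (unit `b2b-balaban-strat-b12` gen 6): DOCSTRING-ONLY — the framing gloss above added (G-ref2-20 (a)); every
declaration, statement and proof is byte-identical to v1 (p179802, commit f650374ba83e).

WHAT IS PROVED (0 sorry).
* §1 a `HomogKernel F A Λ` is continuous, hence integrable, on the hypothesis shell `midShell = {1/2 ≤ ‖x‖_∞ ≤ 2}`.
* §2 NORM-INDEPENDENCE BY DILATION: with the Euclidean balls `ballSq ρ = {|x|₂² ≤ ρ}` one has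
  `ballSq 1 ⊆ closedBall 0 1 ⊆ ballSq 4 ⊆ closedBall 0 2`, `2 • (closedBall 0 1 \ ballSq 1) = closedBall 0 2 \ ballSq 4`, and by
  `Measure.setIntegral_comp_smul_of_pos` + homogeneity `∫_{closedBall 0 2 \ ballSq 4} F = ∫_{closedBall 0 1 \ ballSq 1} F`; the two
  disjoint decompositions of the sup shell and of the Euclidean shell `eShell = ballSq 4 \ ballSq 1` then give
  `integral_shell_eq_integral_eShell : ∫_{1<‖x‖_∞≤2} F = ∫_{1<|x|₂²≤4} F`.
* §3 TRANSPORT to `EuclideanSpace ℝ (Fin 4)` (`PiLp.volume_preserving_toLp`), removal of the null sphere `{|y| = 2}`, and the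
  tree's polar formula `setIntegral_shell_eq_integral_sphereIntegral`: for every `HomogKernel`,
  `integral_shell_eq_log_mul_angAvg : ∫ x in shell, F x = log 2 · angAvg F`, where
  `angAvg F = ∫_{S³} F dσ` (`σ = volume.toSphere`, Mathlib's measure on the Euclidean unit sphere).
* §4 THE ANGULAR MOMENT from a Gaussian: `∫_{ℝ⁴} (x_μx_ν)² e^{−|x|²} dx = π²/4` (product of `∫t²e^{−t²} = √π/2` twice and
  `∫e^{−t²} = √π` twice, all from Mathlib's `integral_rpow_mul_exp_neg_mul_rpow` + `integral_comp_abs`), and by polar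
  coordinates the same integral is `3·angAvg ((x_μx_ν)²)` (`∫₀^∞ r⁷e^{−r²} dr = Γ(4)/2 = 3`); so `angAvg ((x_μx_ν)²) = π²/12`
  and `angAvg (transverseUnit μ ν) = 24·π²/12 = 2π²` (on the unit sphere `|x|₂ = 1`).
* §5 THE VALUE: `integral_shell_transverseUnit : ∫ x in shell, transverseUnit μ ν x = transverseValue (= 2π²·log 2)` for
  `μ ≠ ν`; `unitCoeff_eq_transverseValue : unitCoeff μ ν = transverseValue`; and the binder-free consumers
  `logGrowthLower_twoPiSq` / `logGrowthLower_stepBal'` (= `LeadingCoefficient.logGrowthLower_of_value` / `_stepBal` with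
  `hval` DISCHARGED).
-/

namespace Literature.MathematicalPhysics.QuantumFieldTheory.Balaban1983to89.Beta.ShellValue

open MeasureTheory Finset Real
open scoped Pointwise
open Literature.Analysis.FluidPDE (sphereIntegral sphereIntegral_def setIntegral_shell_eq_integral_sphereIntegral
  integral_eq_integral_Ioi_sphereIntegral)
open Literature.MathematicalPhysics.QuantumFieldTheory.Balaban1983to89.Beta.DyadicShell (HomogKernel)
open Literature.MathematicalPhysics.QuantumFieldTheory.Balaban1983to89.Beta.LargeL (LogGrowthLower)
open Literature.MathematicalPhysics.QuantumFieldTheory.Balaban1983to89.Beta.LargeLWindow (WindowDecomposition)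
open Literature.MathematicalPhysics.QuantumFieldTheory.Balaban1983to89.Beta.LeadingCoefficient (normSq normSq_nonneg
  normSq_smul norm_sq_le_normSq normSq_le abs_apply_le_norm transverseUnit leadingIntegrand unitCoeff transverseValue
  kappaBal kappaBal_pos slope_kappaBal slope_of_value logGrowthLower_of_window)
open Literature.MathematicalPhysics.QuantumFieldTheory.Balaban1983to89.Beta.ShellRiemann (layer mem_layer shell mem_shell
  measurableSet_shell unitCoeff_eq_integral)

noncomputable section

variable {F : (Fin 4 → ℝ) → ℝ} {A Λ : ℝ}

/-- Euclidean four-space (Mathlib's `ℓ²` structure on `Fin 4 → ℝ`). [folklore] -/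
abbrev E4 : Type := EuclideanSpace ℝ (Fin 4)

/-! ## 1. Continuity and integrability on the hypothesis shell `{1/2 ≤ ‖x‖_∞ ≤ 2}` -/

/-- The hypothesis shell `{1/2 ≤ ‖x‖_∞ ≤ 2}` (compact). [folklore] -/
def midShell : Set (Fin 4 → ℝ) := Metric.closedBall 0 2 ∩ {x | 1 / 2 ≤ ‖x‖}

/-- Membership in the hypothesis shell. [folklore] -/
theorem mem_midShell {x : Fin 4 → ℝ} : x ∈ midShell ↔ 1 / 2 ≤ ‖x‖ ∧ ‖x‖ ≤ 2 := by
  rw [midShell, Set.mem_inter_iff, mem_closedBall_zero_iff, Set.mem_setOf_eq]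
  exact and_comm

/-- The hypothesis shell is compact. [folklore] -/
theorem isCompact_midShell : IsCompact midShell :=
  (isCompact_closedBall (0 : Fin 4 → ℝ) 2).inter_right (isClosed_le continuous_const continuous_norm)

/-- A `HomogKernel` is continuous on the hypothesis shell (it is Lipschitz there). [folklore] -/
theorem continuousOn_midShell (hF : HomogKernel F A Λ) : ContinuousOn F midShell := by
  rw [Metric.continuousOn_iff]
  intro x hx ε hε
  obtain ⟨hx1, hx2⟩ := mem_midShell.mp hx
  have hK : 0 < Λ + 1 := by linarith [hF.nonneg_Λ]
  refine ⟨ε / (Λ + 1), div_pos hε hK, fun y hy hxy => ?_⟩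
  obtain ⟨hy1, hy2⟩ := mem_midShell.mp hy
  rw [dist_eq_norm] at hxy
  rw [Real.dist_eq]
  calc |F y - F x| ≤ Λ * ‖y - x‖ := hF.lip y x hy1 hy2 hx1 hx2
    _ ≤ (Λ + 1) * ‖y - x‖ := by gcongr; linarith
    _ < (Λ + 1) * (ε / (Λ + 1)) := by gcongr
    _ = ε := by rw [← mul_div_assoc, mul_div_cancel_left₀ ε hK.ne']

/-- A `HomogKernel` is integrable on the hypothesis shell. [folklore] -/
theorem integrableOn_midShell (hF : HomogKernel F A Λ) : IntegrableOn F midShell volume :=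
  (continuousOn_midShell hF).integrableOn_compact isCompact_midShell

/-! ## 2. Norm-independence of the shell integral by dilation invariance -/

/-- `normSq` is continuous. [folklore] -/
theorem continuous_normSq : Continuous (normSq : (Fin 4 → ℝ) → ℝ) := by
  unfold normSq
  exact continuous_finsetSum _ fun i _ => (continuous_apply i).pow 2

/-- The Euclidean ball `{|x|₂² ≤ ρ}` (parametrised by the squared radius). [folklore] -/
def ballSq (ρ : ℝ) : Set (Fin 4 → ℝ) := {x | normSq x ≤ ρ}

/-- Membership in a Euclidean ball. [folklore] -/
theorem mem_ballSq {ρ : ℝ} {x : Fin 4 → ℝ} : x ∈ ballSq ρ ↔ normSq x ≤ ρ := Iff.rfl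

/-- Euclidean balls are measurable. [folklore] -/
theorem measurableSet_ballSq (ρ : ℝ) : MeasurableSet (ballSq ρ) :=
  measurableSet_le continuous_normSq.measurable measurable_const

/-- The Euclidean shell `{1 < |x|₂² ≤ 4}` in sup-norm coordinates. [folklore] -/
def eShell : Set (Fin 4 → ℝ) := ballSq 4 \ ballSq 1

/-- Membership in the Euclidean shell. [folklore] -/
theorem mem_eShell {x : Fin 4 → ℝ} : x ∈ eShell ↔ 1 < normSq x ∧ normSq x ≤ 4 := by
  rw [eShell, Set.mem_sdiff, mem_ballSq, mem_ballSq, not_le]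
  exact and_comm

/-- The Euclidean shell is measurable. [folklore] -/
theorem measurableSet_eShell : MeasurableSet eShell := (measurableSet_ballSq 4).diff (measurableSet_ballSq 1)

/-- `|x|₂² ≤ 1 ⇒ ‖x‖_∞ ≤ 1`. [folklore] -/
theorem norm_le_one_of_normSq_le_one {x : Fin 4 → ℝ} (h : normSq x ≤ 1) : ‖x‖ ≤ 1 := by
  have h1 := norm_sq_le_normSq x
  nlinarith [norm_nonneg x]

/-- `‖x‖_∞ ≤ 1 ⇒ |x|₂² ≤ 4`. [folklore] -/
theorem normSq_le_four_of_norm_le_one {x : Fin 4 → ℝ} (h : ‖x‖ ≤ 1) : normSq x ≤ 4 := by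
  have h1 := normSq_le x
  nlinarith [norm_nonneg x]

/-- `|x|₂² ≤ 4 ⇒ ‖x‖_∞ ≤ 2`. [folklore] -/
theorem norm_le_two_of_normSq_le_four {x : Fin 4 → ℝ} (h : normSq x ≤ 4) : ‖x‖ ≤ 2 := by
  have h1 := norm_sq_le_normSq x
  nlinarith [norm_nonneg x]

/-- `1 < |x|₂² ⇒ 1/2 < ‖x‖_∞`. [folklore] -/
theorem half_lt_norm_of_one_lt_normSq {x : Fin 4 → ℝ} (h : 1 < normSq x) : 1 / 2 < ‖x‖ := by
  have h1 := normSq_le x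
  nlinarith [norm_nonneg x]

/-- The outer sup layer beyond the Euclidean ball of radius 2. [folklore] -/
def outerPiece : Set (Fin 4 → ℝ) := Metric.closedBall 0 2 \ ballSq 4

/-- The middle piece: inside the Euclidean ball of radius 2, outside the unit sup ball. [folklore] -/
def middlePiece : Set (Fin 4 → ℝ) := ballSq 4 \ Metric.closedBall 0 1

/-- The inner piece: inside the unit sup ball, outside the Euclidean unit ball. [folklore] -/
def innerPiece : Set (Fin 4 → ℝ) := Metric.closedBall 0 1 \ ballSq 1

/-- Membership in the outer piece. [folklore] -/
theorem mem_outerPiece {x : Fin 4 → ℝ} : x ∈ outerPiece ↔ ‖x‖ ≤ 2 ∧ 4 < normSq x := by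
  rw [outerPiece, Set.mem_sdiff, mem_closedBall_zero_iff, mem_ballSq, not_le]

/-- Membership in the middle piece. [folklore] -/
theorem mem_middlePiece {x : Fin 4 → ℝ} : x ∈ middlePiece ↔ normSq x ≤ 4 ∧ 1 < ‖x‖ := by
  rw [middlePiece, Set.mem_sdiff, mem_ballSq, mem_closedBall_zero_iff, not_le]

/-- Membership in the inner piece. [folklore] -/
theorem mem_innerPiece {x : Fin 4 → ℝ} : x ∈ innerPiece ↔ ‖x‖ ≤ 1 ∧ 1 < normSq x := by
  rw [innerPiece, Set.mem_sdiff, mem_closedBall_zero_iff, mem_ballSq, not_le]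

/-- The pieces are measurable. [folklore] -/
theorem measurableSet_outerPiece : MeasurableSet outerPiece := measurableSet_closedBall.diff (measurableSet_ballSq 4)

/-- The pieces are measurable. [folklore] -/
theorem measurableSet_middlePiece : MeasurableSet middlePiece := (measurableSet_ballSq 4).diff measurableSet_closedBall

/-- The pieces are measurable. [folklore] -/
theorem measurableSet_innerPiece : MeasurableSet innerPiece := measurableSet_closedBall.diff (measurableSet_ballSq 1)

/-- The sup shell is the disjoint union of the outer and the middle piece. [folklore] -/
theorem shell_eq_union : shell = outerPiece ∪ middlePiece := by
  ext x
  rw [mem_shell, Set.mem_union, mem_outerPiece, mem_middlePiece]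
  constructor
  · rintro ⟨h1, h2⟩
    by_cases h : normSq x ≤ 4
    · exact Or.inr ⟨h, h1⟩
    · exact Or.inl ⟨h2, not_le.mp h⟩
  · rintro (⟨h2, h4⟩ | ⟨h4, h1⟩)
    · refine ⟨?_, h2⟩
      by_contra h
      have := normSq_le_four_of_norm_le_one (not_lt.mp h)
      linarith
    · exact ⟨h1, norm_le_two_of_normSq_le_four h4⟩

/-- The Euclidean shell is the disjoint union of the middle and the inner piece. [folklore] -/
theorem eShell_eq_union : eShell = middlePiece ∪ innerPiece := by
  ext x
  rw [mem_eShell, Set.mem_union, mem_middlePiece, mem_innerPiece]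
  constructor
  · rintro ⟨h1, h4⟩
    by_cases h : ‖x‖ ≤ 1
    · exact Or.inr ⟨h, h1⟩
    · exact Or.inl ⟨h4, not_le.mp h⟩
  · rintro (⟨h4, h1⟩ | ⟨h1, hn⟩)
    · refine ⟨?_, h4⟩
      by_contra h
      have := norm_le_one_of_normSq_le_one (not_lt.mp h)
      linarith
    · exact ⟨hn, normSq_le_four_of_norm_le_one h1⟩

/-- `outerPiece` and `middlePiece` are disjoint. [folklore] -/
theorem disjoint_outer_middle : Disjoint outerPiece middlePiece :=
  Set.disjoint_left.mpr fun x h1 h2 => by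
    rw [mem_outerPiece] at h1
    rw [mem_middlePiece] at h2
    linarith [h1.2, h2.1]

/-- `middlePiece` and `innerPiece` are disjoint. [folklore] -/
theorem disjoint_middle_inner : Disjoint middlePiece innerPiece :=
  Set.disjoint_left.mpr fun x h1 h2 => by
    rw [mem_middlePiece] at h1
    rw [mem_innerPiece] at h2
    linarith [h1.2, h2.1]

/-- All pieces lie in the hypothesis shell. [folklore] -/
theorem outerPiece_subset : outerPiece ⊆ midShell := fun x hx => by
  rw [mem_outerPiece] at hx
  rw [mem_midShell]
  exact ⟨by linarith [half_lt_norm_of_one_lt_normSq (show 1 < normSq x by linarith [hx.2])], hx.1⟩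

/-- All pieces lie in the hypothesis shell. [folklore] -/
theorem middlePiece_subset : middlePiece ⊆ midShell := fun x hx => by
  rw [mem_middlePiece] at hx
  rw [mem_midShell]
  exact ⟨by linarith [hx.2], norm_le_two_of_normSq_le_four hx.1⟩

/-- All pieces lie in the hypothesis shell. [folklore] -/
theorem innerPiece_subset : innerPiece ⊆ midShell := fun x hx => by
  rw [mem_innerPiece] at hx
  rw [mem_midShell]
  exact ⟨(half_lt_norm_of_one_lt_normSq hx.2).le, by linarith [hx.1]⟩

/-- **THE DILATION**: `2 • innerPiece = outerPiece`. [folklore] -/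
theorem two_smul_innerPiece : (2 : ℝ) • innerPiece = outerPiece := by
  ext x
  rw [Set.mem_smul_set_iff_inv_smul_mem₀ (two_ne_zero), mem_innerPiece, mem_outerPiece, norm_smul, normSq_smul,
    norm_inv, Real.norm_two]
  constructor
  · rintro ⟨h1, h2⟩
    constructor <;> nlinarith
  · rintro ⟨h1, h2⟩
    constructor <;> nlinarith

/-- **DILATION INVARIANCE**: `∫_{outerPiece} F = ∫_{innerPiece} F` for a `HomogKernel` (change of variables `x ↦ 2x`,
Jacobian `2⁴`, against homogeneity `F(2x) = F(x)/2⁴`). [folklore] -/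
theorem integral_outerPiece_eq (hF : HomogKernel F A Λ) :
    ∫ x in outerPiece, F x = ∫ x in innerPiece, F x := by
  have h := Measure.setIntegral_comp_smul_of_pos volume F innerPiece (two_pos : (0 : ℝ) < 2)
  rw [two_smul_innerPiece, Module.finrank_fin_fun, smul_eq_mul] at h
  -- left-hand side: homogeneity on `innerPiece` (where `x ≠ 0`)
  have hl : ∫ x in innerPiece, F ((2 : ℝ) • x) = (∫ x in innerPiece, F x) / 16 := by
    rw [← integral_div]
    refine setIntegral_congr_fun measurableSet_innerPiece fun x hx => ?_
    have hx0 : x ≠ 0 := by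
      intro h0
      rw [mem_innerPiece, h0] at hx
      simp [normSq] at hx
      linarith [hx]
    rw [hF.homog 2 two_pos x hx0]
    norm_num
  rw [hl] at h
  have h16 : ((2 : ℝ) ^ 4)⁻¹ = 1 / 16 := by norm_num
  rw [h16] at h
  linarith

/-- **NORM-INDEPENDENCE OF THE SHELL INTEGRAL**: `∫_{1<‖x‖_∞≤2} F = ∫_{1<|x|₂²≤4} F`. [folklore] -/
theorem integral_shell_eq_integral_eShell (hF : HomogKernel F A Λ) :
    ∫ x in shell, F x = ∫ x in eShell, F x := by
  have hT := integrableOn_midShell hF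
  rw [shell_eq_union, eShell_eq_union,
    setIntegral_union disjoint_outer_middle measurableSet_middlePiece (hT.mono_set outerPiece_subset)
      (hT.mono_set middlePiece_subset),
    setIntegral_union disjoint_middle_inner measurableSet_innerPiece (hT.mono_set middlePiece_subset)
      (hT.mono_set innerPiece_subset),
    integral_outerPiece_eq hF, add_comm]

/-! ## 3. Transport to `EuclideanSpace ℝ (Fin 4)` and polar coordinates -/

/-- `|x|₂² = ‖toLp x‖²`: the explicit `normSq` is the square of Mathlib's Euclidean norm. [folklore] -/
theorem normSq_eq_norm_toLp_sq (x : Fin 4 → ℝ) : normSq x = ‖(WithLp.toLp 2 x : E4)‖ ^ 2 := by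
  rw [EuclideanSpace.real_norm_sq_eq]
  rfl

/-- `normSq (ofLp y) = ‖y‖²`. [folklore] -/
theorem normSq_ofLp (y : E4) : normSq (WithLp.ofLp y) = ‖y‖ ^ 2 := by
  rw [EuclideanSpace.real_norm_sq_eq]
  rfl

/-- The closed-outer Euclidean shell `{1 < ‖y‖ ≤ 2}` in `E4`. [folklore] -/
def eucShell : Set E4 := {y | 1 < ‖y‖ ∧ ‖y‖ ≤ 2}

/-- The open Euclidean shell `{1 < ‖y‖ < 2}` in `E4` (the tree's polar formula is stated for open shells). [folklore] -/
def eucOpen : Set E4 := {y | 1 < ‖y‖ ∧ ‖y‖ < 2}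

/-- The preimage of the Euclidean shell under `toLp` is `eShell`. [folklore] -/
theorem preimage_eucShell : (WithLp.toLp 2 : (Fin 4 → ℝ) → E4) ⁻¹' eucShell = eShell := by
  ext x
  rw [Set.mem_preimage, eucShell, Set.mem_setOf_eq, mem_eShell, normSq_eq_norm_toLp_sq]
  have hn : 0 ≤ ‖(WithLp.toLp 2 x : E4)‖ := norm_nonneg _
  constructor
  · rintro ⟨h1, h2⟩
    constructor <;> nlinarith
  · rintro ⟨h1, h2⟩
    constructor <;> nlinarith

/-- The coordinate map `toLp : (Fin 4 → ℝ) → E4` preserves Lebesgue measure. [folklore] -/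
theorem measurePreserving_toLp : MeasurePreserving (WithLp.toLp 2 : (Fin 4 → ℝ) → E4) volume volume :=
  PiLp.volume_preserving_toLp (Fin 4)

/-- … and is a measurable embedding. [folklore] -/
theorem measurableEmbedding_toLp : MeasurableEmbedding (WithLp.toLp 2 : (Fin 4 → ℝ) → E4) := by
  rw [← MeasurableEquiv.coe_toLp]
  exact (MeasurableEquiv.toLp 2 (Fin 4 → ℝ)).measurableEmbedding

/-- **TRANSPORT**: `∫_{eShell} G = ∫_{eucShell} G ∘ ofLp`. [folklore] -/
theorem integral_eShell_eq (G : (Fin 4 → ℝ) → ℝ) :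
    ∫ x in eShell, G x = ∫ y in eucShell, G (WithLp.ofLp y) := by
  rw [← preimage_eucShell]
  have h := measurePreserving_toLp.setIntegral_preimage_emb measurableEmbedding_toLp
    (fun y : E4 => G (WithLp.ofLp y)) eucShell
  simpa only [WithLp.ofLp_toLp] using h

/-- The open and closed-outer Euclidean shells agree up to the null sphere `{‖y‖ = 2}`. [folklore] -/
theorem eucOpen_ae_eq_eucShell : eucOpen =ᵐ[(volume : Measure E4)] eucShell := by
  refine ae_eq_set.mpr ⟨?_, ?_⟩
  · have h : eucOpen \ eucShell = ∅ := Set.sdiff_eq_empty.mpr fun y hy => ⟨hy.1, hy.2.le⟩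
    rw [h, measure_empty]
  · refine measure_mono_null (fun y hy => ?_) (Measure.addHaar_sphere volume (0 : E4) 2)
    obtain ⟨⟨h1, h2⟩, h3⟩ := hy
    rw [mem_sphere_zero_iff_norm]
    by_contra hne
    exact h3 ⟨h1, lt_of_le_of_ne h2 hne⟩

/-- `ofLp` maps the closed Euclidean shell `{1 ≤ ‖y‖ ≤ 2}` into the hypothesis shell `midShell`. [folklore] -/
theorem ofLp_mem_midShell {y : E4} (h1 : 1 ≤ ‖y‖) (h2 : ‖y‖ ≤ 2) : WithLp.ofLp y ∈ midShell := by
  rw [mem_midShell]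
  have e := normSq_ofLp y
  have hA := norm_sq_le_normSq (WithLp.ofLp y)
  have hB := normSq_le (WithLp.ofLp y)
  have hn := norm_nonneg (WithLp.ofLp y)
  have hy := norm_nonneg y
  constructor
  · nlinarith
  · nlinarith

/-- A `HomogKernel` composed with `ofLp` is integrable on the open Euclidean shell. [folklore] -/
theorem integrableOn_eucOpen (hF : HomogKernel F A Λ) :
    IntegrableOn (fun y : E4 => F (WithLp.ofLp y)) eucOpen volume := by
  have hK : IsCompact (Metric.closedBall (0 : E4) 2 ∩ {y | 1 ≤ ‖y‖}) :=
    (isCompact_closedBall (0 : E4) 2).inter_right (isClosed_le continuous_const continuous_norm)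
  have hcont : ContinuousOn (fun y : E4 => F (WithLp.ofLp y)) (Metric.closedBall (0 : E4) 2 ∩ {y | 1 ≤ ‖y‖}) := by
    refine (continuousOn_midShell hF).comp (PiLp.continuous_ofLp 2 _).continuousOn fun y hy => ?_
    rw [Set.mem_inter_iff, mem_closedBall_zero_iff, Set.mem_setOf_eq] at hy
    exact ofLp_mem_midShell hy.2 hy.1
  refine (hcont.integrableOn_compact hK).mono_set fun y hy => ?_
  obtain ⟨h1, h2⟩ := hy
  rw [Set.mem_inter_iff, mem_closedBall_zero_iff, Set.mem_setOf_eq]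
  exact ⟨h2.le, h1.le⟩

/-- **THE ANGULAR AVERAGE** of `G : ℝ⁴ → ℝ` over the Euclidean unit sphere `S³`, against Mathlib's sphere measure
`σ = volume.toSphere` (total mass `4·vol(B⁴) = 2π²`). [folklore] -/
def angAvg (G : (Fin 4 → ℝ) → ℝ) : ℝ :=
  ∫ α : Metric.sphere (0 : E4) 1, G (WithLp.ofLp (α : E4)) ∂(volume : Measure E4).toSphere

/-- On the unit sphere, `ofLp α ≠ 0`. [folklore] -/
theorem ofLp_sphere_ne_zero (α : Metric.sphere (0 : E4) 1) : WithLp.ofLp (α : E4) ≠ 0 := by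
  intro h
  have h1 : ‖(α : E4)‖ = 1 := norm_eq_of_mem_sphere α
  have h2 : (α : E4) = 0 := by
    rw [← WithLp.toLp_ofLp 2 (α : E4), h, WithLp.toLp_zero]
  rw [h2, norm_zero] at h1
  exact zero_ne_one h1

/-- On the unit sphere, `normSq (ofLp α) = 1`. [folklore] -/
theorem normSq_ofLp_sphere (α : Metric.sphere (0 : E4) 1) : normSq (WithLp.ofLp (α : E4)) = 1 := by
  rw [normSq_ofLp, norm_eq_of_mem_sphere α, one_pow]

/-- **SPHERE INTEGRALS OF A HOMOGENEOUS KERNEL SCALE**: `sphereIntegral (F∘ofLp) r = angAvg F / r⁴` (`r > 0`).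
[folklore] -/
theorem sphereIntegral_homog (hF : HomogKernel F A Λ) {r : ℝ} (hr : 0 < r) :
    sphereIntegral (volume : Measure E4) (fun y : E4 => F (WithLp.ofLp y)) r = angAvg F / r ^ 4 := by
  rw [sphereIntegral_def, angAvg, ← integral_div]
  refine integral_congr_ae (ae_of_all _ fun α => ?_)
  show F (WithLp.ofLp (r • (α : E4))) = F (WithLp.ofLp (α : E4)) / r ^ 4
  rw [WithLp.ofLp_smul, hF.homog r hr _ (ofLp_sphere_ne_zero α)]

/-- `∫_{(1,2)} dr/r = log 2`. [folklore] -/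
theorem integral_inv_Ioo_one_two : ∫ r in Set.Ioo (1 : ℝ) 2, r⁻¹ = Real.log 2 := by
  rw [← integral_Ioc_eq_integral_Ioo, ← intervalIntegral.integral_of_le one_le_two,
    integral_inv_of_pos one_pos two_pos, div_one]

/-- **POLAR REDUCTION FOR THE CLASS**: for every `HomogKernel F A Λ`,
`∫_{1<‖x‖_∞≤2} F dx = log 2 · ∫_{S³} F dσ`. [folklore] -/
theorem integral_shell_eq_log_mul_angAvg (hF : HomogKernel F A Λ) :
    ∫ x in shell, F x = Real.log 2 * angAvg F := by
  rw [integral_shell_eq_integral_eShell hF, integral_eShell_eq, ← setIntegral_congr_set eucOpen_ae_eq_eucShell]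
  have hpol := setIntegral_shell_eq_integral_sphereIntegral (volume : Measure E4)
    (f := fun y : E4 => F (WithLp.ofLp y)) (a := 1) (b := 2) (integrableOn_eucOpen hF) zero_le_one
  have hset : {y : E4 | 1 < ‖y‖ ∧ ‖y‖ < 2} = eucOpen := rfl
  rw [hset] at hpol
  rw [hpol, finrank_euclideanSpace, Fintype.card_fin]
  have hcongr : ∀ r ∈ Set.Ioo (1 : ℝ) 2,
      (r ^ (4 - 1)) • sphereIntegral (volume : Measure E4) (fun y : E4 => F (WithLp.ofLp y)) r =
        angAvg F * r⁻¹ := by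
    intro r hr
    have hr0 : 0 < r := lt_trans one_pos hr.1
    rw [sphereIntegral_homog hF hr0, smul_eq_mul, show (4 - 1 : ℕ) = 3 from rfl, div_eq_mul_inv, pow_succ r 3,
      mul_inv, ← mul_assoc, ← mul_assoc, mul_comm (r ^ 3) (angAvg F), mul_assoc (angAvg F),
      mul_inv_cancel₀ (pow_ne_zero 3 hr0.ne'), mul_one]
  rw [setIntegral_congr_fun measurableSet_Ioo hcongr, integral_const_mul, integral_inv_Ioo_one_two, mul_comm]

/-! ## 4. The angular moment `∫_{S³} (α_μα_ν)² dσ = π²/12` from a Gaussian product integral -/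

/-- The quartic monomial `(x_μx_ν)²`. [folklore] -/
def quartic (μ ν : Fin 4) (x : Fin 4 → ℝ) : ℝ := (x μ * x ν) ^ 2

/-- The Gaussian-weighted monomial `(x_μx_ν)²·e^{−|x|₂²}`. [folklore] -/
def gaussF (μ ν : Fin 4) (x : Fin 4 → ℝ) : ℝ := quartic μ ν x * Real.exp (-normSq x)

/-- Its one-dimensional factors: `t²e^{−t²}` in the directions `μ, ν`, `e^{−t²}` in the others. [folklore] -/
def factor (μ ν : Fin 4) (i : Fin 4) (t : ℝ) : ℝ :=
  if i = μ ∨ i = ν then t ^ 2 * Real.exp (-t ^ 2) else Real.exp (-t ^ 2)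

/-- The set of the two distinguished directions is `{μ, ν}`. [folklore] -/
theorem filter_eq_pair (μ ν : Fin 4) :
    (Finset.univ.filter fun i : Fin 4 => i = μ ∨ i = ν) = {μ, ν} := by
  ext i
  simp [Finset.mem_filter, Finset.mem_insert, Finset.mem_singleton]

/-- **PRODUCT FORM**: for `μ ≠ ν`, `(x_μx_ν)²e^{−|x|²} = ∏_i factor_i(x_i)`. [folklore] -/
theorem gaussF_eq_prod {μ ν : Fin 4} (hμν : μ ≠ ν) (x : Fin 4 → ℝ) :
    gaussF μ ν x = ∏ i, factor μ ν i (x i) := by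
  have hfac : ∀ i, factor μ ν i (x i) = (if i = μ ∨ i = ν then x i ^ 2 else 1) * Real.exp (-x i ^ 2) := by
    intro i
    unfold factor
    split_ifs <;> simp
  simp_rw [hfac]
  rw [Finset.prod_mul_distrib, Finset.prod_ite, Finset.prod_const_one, mul_one, filter_eq_pair,
    Finset.prod_pair hμν, ← Real.exp_sum]
  unfold gaussF quartic normSq
  rw [← Finset.sum_neg_distrib, mul_pow]

/-- The one-dimensional factors are integrable. [folklore] -/
theorem integrable_factor (μ ν i : Fin 4) : Integrable (factor μ ν i) := by
  unfold factor
  by_cases h : i = μ ∨ i = ν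
  · simp only [h, if_true]
    have h2 := integrable_rpow_mul_exp_neg_mul_sq one_pos (s := 2) (by norm_num)
    have e : (fun x : ℝ => x ^ (2 : ℝ) * Real.exp (-1 * x ^ 2)) = fun t => t ^ 2 * Real.exp (-t ^ 2) := by
      funext t
      rw [show (2 : ℝ) = ((2 : ℕ) : ℝ) by norm_num, Real.rpow_natCast, neg_mul, one_mul]
    rw [e] at h2
    exact h2
  · simp only [h, if_false]
    have h0 := integrable_exp_neg_mul_sq one_pos
    have e : (fun x : ℝ => Real.exp (-1 * x ^ 2)) = fun t => Real.exp (-t ^ 2) := by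
      funext t; rw [neg_mul, one_mul]
    rw [e] at h0
    exact h0

/-- `(x_μx_ν)²e^{−|x|²}` is integrable on `ℝ⁴`. [folklore] -/
theorem integrable_gaussF {μ ν : Fin 4} (hμν : μ ≠ ν) : Integrable (gaussF μ ν) := by
  have h := Integrable.fintype_prod (f := factor μ ν) (μ := fun _ : Fin 4 => (volume : Measure ℝ))
    (fun i => integrable_factor μ ν i)
  have e : (fun x : Fin 4 → ℝ => ∏ i, factor μ ν i (x i)) = gaussF μ ν := by
    funext x; rw [gaussF_eq_prod hμν]
  rw [e] at h
  rw [volume_pi]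
  exact h

/-- `∫₀^∞ e^{−u²} du = √π/2`. [folklore] -/
theorem integral_exp_neg_sq_Ioi : ∫ u in Set.Ioi (0 : ℝ), Real.exp (-u ^ 2) = Real.sqrt Real.pi / 2 := by
  have h := integral_rpow_mul_exp_neg_mul_rpow (p := 2) (q := 0) two_pos (by norm_num) one_pos
  have e : ∀ x ∈ Set.Ioi (0 : ℝ), x ^ (0 : ℝ) * Real.exp (-1 * x ^ (2 : ℝ)) = Real.exp (-x ^ 2) := by
    intro x _
    rw [Real.rpow_zero, one_mul, show (2 : ℝ) = ((2 : ℕ) : ℝ) by norm_num, Real.rpow_natCast, neg_mul, one_mul]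
  rw [setIntegral_congr_fun measurableSet_Ioi e] at h
  rw [h, Real.one_rpow, show ((0 : ℝ) + 1) / 2 = 1 / 2 by norm_num, Real.Gamma_one_half_eq]
  ring

/-- `∫₀^∞ u²e^{−u²} du = √π/4`. [folklore] -/
theorem integral_sq_exp_neg_sq_Ioi :
    ∫ u in Set.Ioi (0 : ℝ), u ^ 2 * Real.exp (-u ^ 2) = Real.sqrt Real.pi / 4 := by
  have h := integral_rpow_mul_exp_neg_mul_rpow (p := 2) (q := 2) two_pos (by norm_num) one_pos
  have e : ∀ x ∈ Set.Ioi (0 : ℝ), x ^ (2 : ℝ) * Real.exp (-1 * x ^ (2 : ℝ)) = x ^ 2 * Real.exp (-x ^ 2) := by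
    intro x _
    rw [show (2 : ℝ) = ((2 : ℕ) : ℝ) by norm_num, Real.rpow_natCast, neg_mul, one_mul]
  rw [setIntegral_congr_fun measurableSet_Ioi e] at h
  have hG : Real.Gamma (((2 : ℝ) + 1) / 2) = 1 / 2 * Real.sqrt Real.pi := by
    rw [show ((2 : ℝ) + 1) / 2 = 1 / 2 + 1 by norm_num, Real.Gamma_add_one (by norm_num : (1 : ℝ) / 2 ≠ 0),
      Real.Gamma_one_half_eq]
  rw [h, Real.one_rpow, hG]
  ring

/-- `∫₀^∞ u⁷e^{−u²} du = 3`. [folklore] -/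
theorem integral_pow_seven_exp_neg_sq_Ioi :
    ∫ u in Set.Ioi (0 : ℝ), u ^ 7 * Real.exp (-u ^ 2) = 3 := by
  have h := integral_rpow_mul_exp_neg_mul_rpow (p := 2) (q := 7) two_pos (by norm_num) one_pos
  have e : ∀ x ∈ Set.Ioi (0 : ℝ), x ^ (7 : ℝ) * Real.exp (-1 * x ^ (2 : ℝ)) = x ^ 7 * Real.exp (-x ^ 2) := by
    intro x _
    rw [show (7 : ℝ) = ((7 : ℕ) : ℝ) by norm_num, show (2 : ℝ) = ((2 : ℕ) : ℝ) by norm_num, Real.rpow_natCast,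
      Real.rpow_natCast, neg_mul, one_mul]
  rw [setIntegral_congr_fun measurableSet_Ioi e] at h
  have hG : Real.Gamma (((7 : ℝ) + 1) / 2) = 6 := by
    rw [show ((7 : ℝ) + 1) / 2 = (3 : ℕ) + 1 by norm_num, Real.Gamma_nat_eq_factorial]
    norm_num [Nat.factorial]
  rw [h, Real.one_rpow, hG]
  norm_num

/-- `∫_ℝ e^{−t²} dt = √π`. [folklore] -/
theorem integral_exp_neg_sq : ∫ t : ℝ, Real.exp (-t ^ 2) = Real.sqrt Real.pi := by
  have h := integral_comp_abs (f := fun u => Real.exp (-u ^ 2))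
  simp only [sq_abs] at h
  rw [h, integral_exp_neg_sq_Ioi]
  ring

/-- `∫_ℝ t²e^{−t²} dt = √π/2`. [folklore] -/
theorem integral_sq_exp_neg_sq : ∫ t : ℝ, t ^ 2 * Real.exp (-t ^ 2) = Real.sqrt Real.pi / 2 := by
  have h := integral_comp_abs (f := fun u => u ^ 2 * Real.exp (-u ^ 2))
  simp only [sq_abs] at h
  rw [h, integral_sq_exp_neg_sq_Ioi]
  ring

/-- The integral of a factor. [folklore] -/
theorem integral_factor (μ ν i : Fin 4) :
    ∫ t, factor μ ν i t = if i = μ ∨ i = ν then Real.sqrt Real.pi / 2 else Real.sqrt Real.pi := by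
  unfold factor
  by_cases h : i = μ ∨ i = ν
  · simp only [h, if_true]; exact integral_sq_exp_neg_sq
  · simp only [h, if_false]; exact integral_exp_neg_sq

/-- **THE GAUSSIAN MOMENT**: `∫_{ℝ⁴} (x_μx_ν)² e^{−|x|₂²} dx = π²/4` for `μ ≠ ν`. [folklore] -/
theorem integral_gaussF {μ ν : Fin 4} (hμν : μ ≠ ν) : ∫ x, gaussF μ ν x = Real.pi ^ 2 / 4 := by
  have e : gaussF μ ν = fun x : Fin 4 → ℝ => ∏ i, factor μ ν i (x i) := by
    funext x; rw [gaussF_eq_prod hμν]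
  rw [e, integral_fintype_prod_volume_eq_prod (𝕜 := ℝ) (factor μ ν)]
  simp_rw [integral_factor]
  rw [Finset.prod_ite, Finset.prod_const, Finset.prod_const, filter_eq_pair, Finset.card_pair hμν]
  have hcard : (Finset.univ.filter fun i : Fin 4 => ¬(i = μ ∨ i = ν)).card = 2 := by
    have h := Finset.card_filter_add_card_filter_not (s := (Finset.univ : Finset (Fin 4)))
      (fun i : Fin 4 => i = μ ∨ i = ν)
    rw [filter_eq_pair, Finset.card_pair hμν, Finset.card_univ, Fintype.card_fin] at h
    omega
  rw [hcard]
  have hπ : Real.sqrt Real.pi ^ 2 = Real.pi := Real.sq_sqrt Real.pi_pos.le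
  nlinarith [hπ]

/-- The Gaussian-weighted monomial on `E4`. [folklore] -/
def gaussE (μ ν : Fin 4) (y : E4) : ℝ := gaussF μ ν (WithLp.ofLp y)

/-- Transport of the Gaussian moment to `E4`. [folklore] -/
theorem integral_gaussE {μ ν : Fin 4} (hμν : μ ≠ ν) : ∫ y, gaussE μ ν y = Real.pi ^ 2 / 4 := by
  have hmp : MeasurePreserving (⇑(MeasurableEquiv.toLp 2 (Fin 4 → ℝ))) (volume : Measure (Fin 4 → ℝ))
      (volume : Measure E4) := by
    rw [MeasurableEquiv.coe_toLp]; exact measurePreserving_toLp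
  have h := hmp.integral_comp' (gaussE μ ν)
  have e : (fun x : Fin 4 → ℝ => gaussE μ ν ((MeasurableEquiv.toLp 2 (Fin 4 → ℝ)) x)) = gaussF μ ν := by
    funext x
    rw [MeasurableEquiv.coe_toLp]
    rfl
  rw [e] at h
  calc ∫ y, gaussE μ ν y = ∫ x, gaussF μ ν x := h.symm
    _ = Real.pi ^ 2 / 4 := integral_gaussF hμν

/-- `gaussE` is integrable on `E4`. [folklore] -/
theorem integrable_gaussE {μ ν : Fin 4} (hμν : μ ≠ ν) : Integrable (gaussE μ ν) (volume : Measure E4) := by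
  have h := (measurePreserving_toLp.integrable_comp_emb measurableEmbedding_toLp (g := gaussE μ ν))
  have e : gaussE μ ν ∘ (WithLp.toLp 2 : (Fin 4 → ℝ) → E4) = gaussF μ ν := by
    funext x; simp [gaussE, Function.comp]
  rw [e] at h
  exact h.mp (integrable_gaussF hμν)

/-- Sphere integrals of `gaussE`: `sphereIntegral gaussE r = r⁴e^{−r²}·angAvg (quartic μ ν)` (any real `r`). [folklore] -/
theorem sphereIntegral_gaussE (μ ν : Fin 4) (r : ℝ) :
    sphereIntegral (volume : Measure E4) (gaussE μ ν) r = r ^ 4 * Real.exp (-r ^ 2) * angAvg (quartic μ ν) := by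
  rw [sphereIntegral_def, angAvg, ← integral_const_mul]
  refine integral_congr_ae (ae_of_all _ fun α => ?_)
  show gaussF μ ν (WithLp.ofLp (r • (α : E4))) = r ^ 4 * Real.exp (-r ^ 2) * quartic μ ν (WithLp.ofLp (α : E4))
  rw [WithLp.ofLp_smul]
  unfold gaussF quartic
  rw [normSq_smul, normSq_ofLp_sphere, Pi.smul_apply, Pi.smul_apply, smul_eq_mul, smul_eq_mul]
  ring_nf

/-- **POLAR FORM OF THE GAUSSIAN MOMENT**: `∫_{E4} gaussE = 3·angAvg (quartic μ ν)`. [folklore] -/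
theorem integral_gaussE_eq_angAvg {μ ν : Fin 4} (hμν : μ ≠ ν) :
    ∫ y, gaussE μ ν y = 3 * angAvg (quartic μ ν) := by
  rw [integral_eq_integral_Ioi_sphereIntegral (volume : Measure E4) (integrable_gaussE hμν), finrank_euclideanSpace,
    Fintype.card_fin]
  have hcongr : ∀ r ∈ Set.Ioi (0 : ℝ),
      (r ^ (4 - 1)) • sphereIntegral (volume : Measure E4) (gaussE μ ν) r =
        angAvg (quartic μ ν) * (r ^ 7 * Real.exp (-r ^ 2)) := by
    intro r _
    rw [sphereIntegral_gaussE μ ν r, smul_eq_mul]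
    ring
  rw [setIntegral_congr_fun measurableSet_Ioi hcongr, integral_const_mul, integral_pow_seven_exp_neg_sq_Ioi]
  ring

/-- **THE ANGULAR MOMENT**: `∫_{S³} (α_μα_ν)² dσ = π²/12` for `μ ≠ ν`. [folklore] -/
theorem angAvg_quartic {μ ν : Fin 4} (hμν : μ ≠ ν) : angAvg (quartic μ ν) = Real.pi ^ 2 / 12 := by
  have h1 := integral_gaussE_eq_angAvg hμν
  have h2 := integral_gaussE hμν
  linarith

/-- On the unit sphere the transverse structure is `24·(α_μα_ν)²`; hence `angAvg T_{μν} = 24·angAvg (quartic μ ν)`.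
[folklore] -/
theorem angAvg_transverseUnit (μ ν : Fin 4) : angAvg (transverseUnit μ ν) = 24 * angAvg (quartic μ ν) := by
  rw [angAvg, angAvg, ← integral_const_mul]
  refine integral_congr_ae (ae_of_all _ fun α => ?_)
  show transverseUnit μ ν (WithLp.ofLp (α : E4)) = 24 * quartic μ ν (WithLp.ofLp (α : E4))
  unfold transverseUnit quartic
  rw [normSq_ofLp_sphere, one_pow, div_one]

/-- `∫_{S³} T_{μν} dσ = 2π²` for `μ ≠ ν`. [folklore] -/
theorem angAvg_transverseUnit_eq {μ ν : Fin 4} (hμν : μ ≠ ν) : angAvg (transverseUnit μ ν) = 2 * Real.pi ^ 2 := by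
  rw [angAvg_transverseUnit, angAvg_quartic hμν]; ring

/-! ## 5. The value, and the binder-free consumers -/

/-- **THE VALUE**: `∫_{1<‖x‖_∞≤2} 24·x_μ²x_ν²/|x|₂⁸ dx = 2π²·log 2 = transverseValue` for `μ ≠ ν`. [folklore] -/
theorem integral_shell_transverseUnit {μ ν : Fin 4} (hμν : μ ≠ ν) :
    ∫ x in shell, transverseUnit μ ν x = transverseValue := by
  rw [integral_shell_eq_log_mul_angAvg (LeadingCoefficient.homogKernel_transverseUnit μ ν),
    angAvg_transverseUnit_eq hμν, transverseValue]
  ring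

/-- **G-beta-an3-5 CLOSED**: the unit coefficient of `Beta.LeadingCoefficient` has its continuum value,
`unitCoeff μ ν = 2π²·log 2` (`μ ≠ ν`). [folklore] -/
theorem unitCoeff_eq_transverseValue {μ ν : Fin 4} (hμν : μ ≠ ν) : unitCoeff μ ν = transverseValue := by
  rw [unitCoeff_eq_integral, integral_shell_transverseUnit hμν]

section Consumers

variable {β0 : ℕ → ℕ → ℝ} {Ch Cg A₁ c : ℝ} {M : ℕ → ℕ} {κ : ℝ} {μ ν : Fin 4}

/-- **BINDER-FREE (AF-0-L) SLOPE**: under the window decomposition with leading kernel `κ·T∘toReal`, `κ ≥ 0`, `μ ≠ ν`,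
the slope is `2π²κ` (`LeadingCoefficient.logGrowthLower_of_value` with `hval` discharged). [folklore] -/
theorem logGrowthLower_twoPiSq
    (W : WindowDecomposition β0 (fun w => leadingIntegrand κ μ ν (DyadicShell.toReal w)) Ch Cg A₁ c M) (hκ : 0 ≤ κ)
    (hμν : μ ≠ ν) :
    LogGrowthLower β0 (2 * Real.pi ^ 2 * κ) (WindowDecomposition.constA Ch Cg A₁ c (κ * transverseValue)) :=
  LeadingCoefficient.logGrowthLower_of_value W hκ (unitCoeff_eq_transverseValue hμν)

/-- **BINDER-FREE PRINTED SLOPE**: with `κ = kappaBal N = 11N²/(24π⁴)` the (AF-0-L) lower bound reads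
`stepBal N L − A ≤ β0 L k` for all `L ≥ 2`, all `k` — the slope is EXACTLY `B12Normalization.stepBal N L / log L =
11N²/(12π²)` (`LeadingCoefficient.logGrowthLower_stepBal` with `hval` discharged).  Whether Bałaban's window kernel HAS this
form is the open shape hypothesis `W` (rows (L1)–(L3)); nothing of it is asserted. [folklore] -/
theorem logGrowthLower_stepBal' {N : ℝ}
    (W : WindowDecomposition β0 (fun w => leadingIntegrand (kappaBal N) μ ν (DyadicShell.toReal w)) Ch Cg A₁ c M)
    (hN : N ≠ 0) (hμν : μ ≠ ν) :
    ∀ L : ℕ, 2 ≤ L → ∀ k : ℕ,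
      B12Normalization.stepBal N L - WindowDecomposition.constA Ch Cg A₁ c (kappaBal N * transverseValue) ≤ β0 L k :=
  LeadingCoefficient.logGrowthLower_stepBal W hN (unitCoeff_eq_transverseValue hμν)

end Consumers

end

end Literature.MathematicalPhysics.QuantumFieldTheory.Balaban1983to89.Beta.ShellValue
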